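import Summits.BirchSwinnertonDyer.BirchSwinnertonDyer.Theorems.Rank2ObservatoryRank2Table
import Summits.BirchSwinnertonDyer.BirchSwinnertonDyer.Theorems.Rank2ObservatoryRank2Rows70a
import Summits.BirchSwinnertonDyer.BirchSwinnertonDyer.Theorems.Rank2ObservatoryRank2Rows70b
import Summits.BirchSwinnertonDyer.BirchSwinnertonDyer.Theorems.Rank2ObservatoryRank2Rows71a
import Summits.BirchSwinnertonDyer.BirchSwinnertonDyer.Theorems.Rank2ObservatoryRank2Rows71b
import Summits.BirchSwinnertonDyer.BirchSwinnertonDyer.Theorems.Rank2ObservatoryRank2Rows72a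
import Summits.BirchSwinnertonDyer.BirchSwinnertonDyer.Theorems.Rank2ObservatoryRank2Rows72b
import Summits.BirchSwinnertonDyer.BirchSwinnertonDyer.Theorems.Rank2ObservatoryRank2Rows73a
import Summits.BirchSwinnertonDyer.BirchSwinnertonDyer.Theorems.Rank2ObservatoryRank2Rows73b
import Summits.BirchSwinnertonDyer.BirchSwinnertonDyer.Theorems.Rank2ObservatoryRank2Rows74a
import Summits.BirchSwinnertonDyer.BirchSwinnertonDyer.Theorems.Rank2ObservatoryRank2Rows74b
import Summits.BirchSwinnertonDyer.BirchSwinnertonDyer.Theorems.Rank2ObservatoryRank2Rows75a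
import Summits.BirchSwinnertonDyer.BirchSwinnertonDyer.Theorems.Rank2ObservatoryRank2Rows75b
import Summits.BirchSwinnertonDyer.BirchSwinnertonDyer.Theorems.Rank2ObservatoryRank2Rows76a
import Summits.BirchSwinnertonDyer.BirchSwinnertonDyer.Theorems.Rank2ObservatoryRank2Rows76b
import Summits.BirchSwinnertonDyer.BirchSwinnertonDyer.Theorems.Rank2ObservatoryRank2Rows77a
import Summits.BirchSwinnertonDyer.BirchSwinnertonDyer.Theorems.Rank2ObservatoryRank2Rows77b
import Summits.BirchSwinnertonDyer.BirchSwinnertonDyer.Theorems.Rank2ObservatoryRank2Rows78a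
import Summits.BirchSwinnertonDyer.BirchSwinnertonDyer.Theorems.Rank2ObservatoryRank2Rows78b
import Summits.BirchSwinnertonDyer.BirchSwinnertonDyer.Theorems.Rank2ObservatoryRank2Rows79a
import Summits.BirchSwinnertonDyer.BirchSwinnertonDyer.Theorems.Rank2ObservatoryRank2Rows79b
import HarnessLib

/-!
# BirchSwinnertonDyer — rank ≥ 2 observatory: rank-2 census table, decade 7 of 10 (`350000 ≤ N < 400000`)

HONEST FRAMING: per-curve certified theorems and census instruments; no claim on BSD in rank ≥ 2.

Machine-written AGGREGATION level of the rank-2 census (schema `Rank2ObservatoryRank2Table.lean`, data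
chunks `Rank2ObservatoryRank2Rows70a … 79b`, census `Rank2ObservatoryRank2Census.lean`): `rank2Decade7` is the
concatenation of the 20 chunks of conductor windows 70–79 (`350000 ≤ N < 400000`; a window above the gate's
200 kB file cap is stored as two half-window chunks `NNa`, `NNb`) — rows 237178–274346 of `rank2_table.tsv`
(sha256 `8b151c933b69ee8dae4834c21efd171353ae94c887716c05b7381d12d173f912`), 37169 curves from `350002a1` to
`399993f4`. Its theorems are assembled from the chunk theorems (each a kernel `decide`) by
`List.all_append` / `List.length_append` rewriting only; no row is re-evaluated here. The two-level
assembly (chunks → decades → table) keeps every file under the tree's 400-line limit and every list short.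

Reference: J. E. Cremona, *Algorithms for Modular Elliptic Curves* (2nd ed. 1997), tables / ecdata.
-/

-- single-conjunct summit: `Summit.BirchSwinnertonDyer.BirchSwinnertonDyer.…` repeats the name by design
set_option linter.dupNamespace false

namespace Summit.BirchSwinnertonDyer.BirchSwinnertonDyer.Rank2Observatory

/-- The 20 chunks of decade 7 (conductors `350000 ≤ N < 400000`), in order. [cite: CremonaAlgorithms1997, Tables] -/
noncomputable def rank2Decade7Chunks : List (List Rank2Row) := [
  rank2Rows70a, rank2Rows70b, rank2Rows71a, rank2Rows71b, rank2Rows72a, rank2Rows72b,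
  rank2Rows73a, rank2Rows73b, rank2Rows74a, rank2Rows74b, rank2Rows75a, rank2Rows75b,
  rank2Rows76a, rank2Rows76b, rank2Rows77a, rank2Rows77b, rank2Rows78a, rank2Rows78b,
  rank2Rows79a, rank2Rows79b]

/-- Decade 7 of the rank-2 census table: the 37169 rank-2 curves of conductor `350000 ≤ N < 400000` (rows 237178–274346).
[cite: CremonaAlgorithms1997, Tables] -/
noncomputable def rank2Decade7 : List Rank2Row :=
  rank2Decade7Chunks.flatten

/-- Every row of decade 7 satisfies `Rank2Row.check` (from the 20 chunk theorems). [folklore] -/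
theorem rank2Decade7_check : rank2Decade7.all Rank2Row.check = true := by
  simp only [rank2Decade7, rank2Decade7Chunks, List.flatten_cons, List.flatten_nil, List.all_append, List.all_nil,
    Bool.and_true,
    rank2Rows70a_check, rank2Rows70b_check, rank2Rows71a_check, rank2Rows71b_check,
    rank2Rows72a_check, rank2Rows72b_check, rank2Rows73a_check, rank2Rows73b_check,
    rank2Rows74a_check, rank2Rows74b_check, rank2Rows75a_check, rank2Rows75b_check,
    rank2Rows76a_check, rank2Rows76b_check, rank2Rows77a_check, rank2Rows77b_check,
    rank2Rows78a_check, rank2Rows78b_check, rank2Rows79a_check, rank2Rows79b_check]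

/-- Decade 7 has `37169` rows (sum of the 20 kernel-counted chunk lengths). [cite: CremonaAlgorithms1997, Tables] -/
theorem rank2Decade7_length : rank2Decade7.length = 37169 := by
  simp only [rank2Decade7, rank2Decade7Chunks, List.flatten_cons, List.flatten_nil, List.length_append, List.length_nil,
    rank2Rows70a_length, rank2Rows70b_length, rank2Rows71a_length, rank2Rows71b_length,
    rank2Rows72a_length, rank2Rows72b_length, rank2Rows73a_length, rank2Rows73b_length,
    rank2Rows74a_length, rank2Rows74b_length, rank2Rows75a_length, rank2Rows75b_length,
    rank2Rows76a_length, rank2Rows76b_length, rank2Rows77a_length, rank2Rows77b_length,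
    rank2Rows78a_length, rank2Rows78b_length, rank2Rows79a_length, rank2Rows79b_length]

/-- Every conductor of decade 7 is `< 500 000` (from the 20 kernel-checked chunk ranges).
[cite: CremonaAlgorithms1997, Tables] -/
theorem rank2Decade7_conductor_lt : rank2Decade7.all (fun r => decide (r.N < 500000)) = true := by
  simp only [rank2Decade7, rank2Decade7Chunks, List.flatten_cons, List.flatten_nil, List.all_append, List.all_nil,
    Bool.and_true,
    Rank2Row.all_conductorLt_of_all_range (by norm_num) rank2Rows70a_conductor,
    Rank2Row.all_conductorLt_of_all_range (by norm_num) rank2Rows70b_conductor,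
    Rank2Row.all_conductorLt_of_all_range (by norm_num) rank2Rows71a_conductor,
    Rank2Row.all_conductorLt_of_all_range (by norm_num) rank2Rows71b_conductor,
    Rank2Row.all_conductorLt_of_all_range (by norm_num) rank2Rows72a_conductor,
    Rank2Row.all_conductorLt_of_all_range (by norm_num) rank2Rows72b_conductor,
    Rank2Row.all_conductorLt_of_all_range (by norm_num) rank2Rows73a_conductor,
    Rank2Row.all_conductorLt_of_all_range (by norm_num) rank2Rows73b_conductor,
    Rank2Row.all_conductorLt_of_all_range (by norm_num) rank2Rows74a_conductor,
    Rank2Row.all_conductorLt_of_all_range (by norm_num) rank2Rows74b_conductor,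
    Rank2Row.all_conductorLt_of_all_range (by norm_num) rank2Rows75a_conductor,
    Rank2Row.all_conductorLt_of_all_range (by norm_num) rank2Rows75b_conductor,
    Rank2Row.all_conductorLt_of_all_range (by norm_num) rank2Rows76a_conductor,
    Rank2Row.all_conductorLt_of_all_range (by norm_num) rank2Rows76b_conductor,
    Rank2Row.all_conductorLt_of_all_range (by norm_num) rank2Rows77a_conductor,
    Rank2Row.all_conductorLt_of_all_range (by norm_num) rank2Rows77b_conductor,
    Rank2Row.all_conductorLt_of_all_range (by norm_num) rank2Rows78a_conductor,
    Rank2Row.all_conductorLt_of_all_range (by norm_num) rank2Rows78b_conductor,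
    Rank2Row.all_conductorLt_of_all_range (by norm_num) rank2Rows79a_conductor,
    Rank2Row.all_conductorLt_of_all_range (by norm_num) rank2Rows79b_conductor]

/-- A row of a chunk of decade 7 is a row of the decade. [folklore] -/
theorem mem_rank2Decade7_of_mem_chunk {l : List Rank2Row} (hl : l ∈ rank2Decade7Chunks) {r : Rank2Row} (hr : r ∈ l) :
    r ∈ rank2Decade7 :=
  List.mem_flatten.mpr ⟨l, hl, hr⟩

/-- Chunk 70a is a chunk of decade 7. [folklore] -/
theorem rank2Rows70a_mem_decade7 : rank2Rows70a ∈ rank2Decade7Chunks :=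
  List.mem_iff_getElem?.mpr ⟨0, rfl⟩

/-- Chunk 70b is a chunk of decade 7. [folklore] -/
theorem rank2Rows70b_mem_decade7 : rank2Rows70b ∈ rank2Decade7Chunks :=
  List.mem_iff_getElem?.mpr ⟨1, rfl⟩

/-- Chunk 71a is a chunk of decade 7. [folklore] -/
theorem rank2Rows71a_mem_decade7 : rank2Rows71a ∈ rank2Decade7Chunks :=
  List.mem_iff_getElem?.mpr ⟨2, rfl⟩

/-- Chunk 71b is a chunk of decade 7. [folklore] -/
theorem rank2Rows71b_mem_decade7 : rank2Rows71b ∈ rank2Decade7Chunks :=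
  List.mem_iff_getElem?.mpr ⟨3, rfl⟩

/-- Chunk 72a is a chunk of decade 7. [folklore] -/
theorem rank2Rows72a_mem_decade7 : rank2Rows72a ∈ rank2Decade7Chunks :=
  List.mem_iff_getElem?.mpr ⟨4, rfl⟩

/-- Chunk 72b is a chunk of decade 7. [folklore] -/
theorem rank2Rows72b_mem_decade7 : rank2Rows72b ∈ rank2Decade7Chunks :=
  List.mem_iff_getElem?.mpr ⟨5, rfl⟩

/-- Chunk 73a is a chunk of decade 7. [folklore] -/
theorem rank2Rows73a_mem_decade7 : rank2Rows73a ∈ rank2Decade7Chunks :=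
  List.mem_iff_getElem?.mpr ⟨6, rfl⟩

/-- Chunk 73b is a chunk of decade 7. [folklore] -/
theorem rank2Rows73b_mem_decade7 : rank2Rows73b ∈ rank2Decade7Chunks :=
  List.mem_iff_getElem?.mpr ⟨7, rfl⟩

/-- Chunk 74a is a chunk of decade 7. [folklore] -/
theorem rank2Rows74a_mem_decade7 : rank2Rows74a ∈ rank2Decade7Chunks :=
  List.mem_iff_getElem?.mpr ⟨8, rfl⟩

/-- Chunk 74b is a chunk of decade 7. [folklore] -/
theorem rank2Rows74b_mem_decade7 : rank2Rows74b ∈ rank2Decade7Chunks :=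
  List.mem_iff_getElem?.mpr ⟨9, rfl⟩

/-- Chunk 75a is a chunk of decade 7. [folklore] -/
theorem rank2Rows75a_mem_decade7 : rank2Rows75a ∈ rank2Decade7Chunks :=
  List.mem_iff_getElem?.mpr ⟨10, rfl⟩

/-- Chunk 75b is a chunk of decade 7. [folklore] -/
theorem rank2Rows75b_mem_decade7 : rank2Rows75b ∈ rank2Decade7Chunks :=
  List.mem_iff_getElem?.mpr ⟨11, rfl⟩

/-- Chunk 76a is a chunk of decade 7. [folklore] -/
theorem rank2Rows76a_mem_decade7 : rank2Rows76a ∈ rank2Decade7Chunks :=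
  List.mem_iff_getElem?.mpr ⟨12, rfl⟩

/-- Chunk 76b is a chunk of decade 7. [folklore] -/
theorem rank2Rows76b_mem_decade7 : rank2Rows76b ∈ rank2Decade7Chunks :=
  List.mem_iff_getElem?.mpr ⟨13, rfl⟩

/-- Chunk 77a is a chunk of decade 7. [folklore] -/
theorem rank2Rows77a_mem_decade7 : rank2Rows77a ∈ rank2Decade7Chunks :=
  List.mem_iff_getElem?.mpr ⟨14, rfl⟩

/-- Chunk 77b is a chunk of decade 7. [folklore] -/
theorem rank2Rows77b_mem_decade7 : rank2Rows77b ∈ rank2Decade7Chunks :=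
  List.mem_iff_getElem?.mpr ⟨15, rfl⟩

/-- Chunk 78a is a chunk of decade 7. [folklore] -/
theorem rank2Rows78a_mem_decade7 : rank2Rows78a ∈ rank2Decade7Chunks :=
  List.mem_iff_getElem?.mpr ⟨16, rfl⟩

/-- Chunk 78b is a chunk of decade 7. [folklore] -/
theorem rank2Rows78b_mem_decade7 : rank2Rows78b ∈ rank2Decade7Chunks :=
  List.mem_iff_getElem?.mpr ⟨17, rfl⟩

/-- Chunk 79a is a chunk of decade 7. [folklore] -/
theorem rank2Rows79a_mem_decade7 : rank2Rows79a ∈ rank2Decade7Chunks :=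
  List.mem_iff_getElem?.mpr ⟨18, rfl⟩

/-- Chunk 79b is a chunk of decade 7. [folklore] -/
theorem rank2Rows79b_mem_decade7 : rank2Rows79b ∈ rank2Decade7Chunks :=
  List.mem_iff_getElem?.mpr ⟨19, rfl⟩

end Summit.BirchSwinnertonDyer.BirchSwinnertonDyer.Rank2Observatory
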